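import Summits.CriticalPhenomena.PercolationContinuityZ3.Theorems.Transplant.SkelPhiWinChainF
import Summits.CriticalPhenomena.PercolationContinuityZ3.Theorems.Transplant.KNCells2ChainAppend
import Summits.CriticalPhenomena.PercolationContinuityZ3.Theorems.Transplant.KNLevelsChainTransfer
import Summits.CriticalPhenomena.PercolationContinuityZ3.Theorems.Transplant.SkelRouteLaw
import HarnessLib

/-!
# N1 ({±1} node), (F) inner route under RULING B.15 (hp-8 g33): **CHAIN FACTS, APPENDABLE** — the ℕ-indexed form of the linked step family the
# KNLevels chain property consumes (constant source, links `T'_k ⊆ X^{(k+1)}_0`, `T'_k ⊆ T_k`, `KitsAt`, rim excess `≤ η`), produced by ONE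
# schedule-frame segment (p1-g11's `kitsAt_stepAF`) and closed under APPENDING along a cross link (p5-g8's `ChainPlanar.pw`); so the (F) route of
# RULING B.15 — hop + bridge + along band + tangential band, THREE windows — and any longer composite is assembled segment by segment, and
# `lt_real_of_chainFacts` / `lt_real_linkIn_of_chainFacts` apply the chain property once (generalising my two-window `lt_real_of_chainF₂`, p289460)

builds on p205010 (kernel theorem, internal audit signed; external expert review pending) — nothing in this file uses p205010; nothing here is a
claim about the open node `SamePDropOfSkeletonNeg`.
Lane `prim-bschramm`, seat `prim-hp-8` (gen 33); helper file (`--supports stmt-CriticalPhenomena-4575 --as helper`).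
* §1 `Skelφ.ChainFacts` (structure, Prop), `chainFacts_seg` (one segment), `chainFacts_append` (two families along a cross link), `ChainFacts.mono_le`;
* §2 **`lt_real_of_chainFacts`**, **`lt_real_linkIn_of_chainFacts`** (route-law form under `Skel.routeW`).
[cite: KozmaNitzan2024, §4 Lemma 11 (pp. 22–23), Lemma 12 (pp. 23–25), p. 20 (Step IV), p. 24 (P(o ↔^A ·))]
-/

noncomputable section

open MeasureTheory ProbabilityTheory
open scoped ENNReal

namespace Summit.CriticalPhenomena.PercolationContinuityZ3.Theorems.Transplant

namespace Skelφ

open Literature.Probability.Percolation Literature.Probability.LatticeModels SimpleGraph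
open Literature.Probability.Percolation.KozmaNitzan
open KNLevels ChainPlanar

variable {V : Type} [DecidableEq V] {G' : SimpleGraph V} [G'.LocallyFinite]

/-! ## §1 Chain facts: one segment, appending -/

/-- **The ℕ-indexed facts of a linked step family of length `n + 1`** with source `o`, true targets `T'`, under the weighting `W'`: constant source,
links, `T' ⊆ T`, kits at every step, rim excess `≤ η`. [cite: KozmaNitzan2024, §4 Lemma 12 (pp. 23–25)] -/
structure ChainFacts (W' : Sym2 V → unitInterval) (p : unitInterval) (Δ' : ℕ) (δ η : ℝ) (o : V) (s : ℕ → TStep G') (T' : ℕ → Finset V)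
    (n : ℕ) : Prop where
  /-- constant source -/
  src : ∀ k ≤ n, (s k).L.o = o
  /-- the true target of step `k` lies in the first level of step `k + 1` -/
  link : ∀ k, k + 1 ≤ n → T' k ⊆ (s (k + 1)).L.X 0
  /-- true targets are targets -/
  sub : ∀ k ≤ n, T' k ⊆ (s k).T
  /-- kits at every step -/
  kits : ∀ k ≤ n, (s k).KitsAt W' p Δ' δ
  /-- the rim excess -/
  exc : ∀ k ≤ n, (prodBernoulli W').real (⋃ t ∈ (s k).T \ T' k, openConn o t) ≤ η

namespace WinChainData

variable (P : WinChainData V) (𝒲 : PlanarWindow G') (S : SchedFrame)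

/-- **ONE SEGMENT**: the steps `stepAF` / true targets `coreTF` of a schedule frame read through a planar window satisfy the chain facts, from the
hypotheses of `kitsAt_stepAF` at every step and the rim excess. [cite: KozmaNitzan2024, §4 Lemma 11 (pp. 22–23), Lemma 12] -/
theorem chainFacts_seg (hRl : P.Rlev + 1 ≤ S.R') (hRim : ∀ k, P.Rim k ⊆ 𝒲.stepDF S k) (hTne : ∀ k ≤ S.N, (𝒲.coreTF S k).Nonempty)
    {p : unitInterval} {W' : Sym2 V → unitInterval} {Δ' : ℕ} {δ η : ℝ}
    (hsub : ∀ k ≤ S.N, IsSubbox G' W' p (𝒲.stepDF S k)) (hfin : FinSupp W' P.Sfin) (hDS : ∀ k ≤ S.N, 𝒲.stepDF S k ⊆ P.Sfin)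
    (ho : ∀ k ≤ S.N, P.o ∉ 𝒲.stepDF S k) (hoS : P.o ∈ P.Sfin) (hj : P.j₁ ≤ P.Rlev)
    (hcount : 1 / (1 - (p : ℝ)) ^ (Δ' * P.N) ≤ δ * ((Finset.Icc P.j₀ P.j₁).card : ℝ))
    (hkits : ∀ k ≤ S.N, ∀ j ∈ Finset.Icc P.j₀ P.j₁, ∃ (σ : SData V) (Sz : Finset V),
      SHyp (P.stepLF 𝒲 S k) j σ ∧ σ.N ≤ P.N ∧
      (1 - (p : ℝ) ^ σ.sB) ^ σ.k ≤ δ ∧ Sz ⊆ (P.stepLF 𝒲 S k).X j ∧ Sz ⊆ 𝒲.stepDF S k ∧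
      (∀ x ∈ σ.K, ∀ e ∈ σ.seed x, e ∉ wireSet (↑Sz : Set V)) ∧ (∀ x ∈ σ.K, σ.face x ⊆ Sz) ∧
      (∀ x ∈ σ.K, 1 - 3 * δ ≤ (prodBernoulli W').real {ω | ∃ u ∈ σ.face x,
        1 - δ < (prodBernoulli (pinW W' (wireSet (↑Sz : Set V)) ω)).real
          (⋃ t ∈ P.coreEF 𝒲 S k, openConnIn (↑(𝒲.stepDF S k) : Set V) u t)}))
    (hexc : ∀ k ≤ S.N, (prodBernoulli W').real (⋃ t ∈ P.Rim k, openConn P.o t) ≤ η) :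
    ChainFacts W' p Δ' δ η P.o (fun k => P.stepAF 𝒲 S k) (fun k => 𝒲.coreTF S k) S.N where
  src k _ := P.stepAF_o 𝒲 S k
  link k _ := P.coreTF_subset_X_zero_succ 𝒲 S k
  sub k _ := P.coreTF_subset_coreEF 𝒲 S k
  kits k hk := P.kitsAt_stepAF 𝒲 S hRl hRim hk (hTne k hk) (hsub k hk) hfin (hDS k hk) (ho k hk) hoS hj hcount (hkits k hk)
  exc k hk := by
    refine le_trans (measureReal_mono ?_ (measure_ne_top _ _)) (hexc k hk)
    intro ω hω
    simp only [Set.mem_iUnion, exists_prop] at hω ⊢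
    obtain ⟨t, ht, hωt⟩ := hω
    exact ⟨t, P.coreEF_sdiff_subset 𝒲 S k ht, hωt⟩

end WinChainData

namespace ChainFacts

variable {W' : Sym2 V → unitInterval} {p : unitInterval} {Δ' : ℕ} {δ η : ℝ} {o : V}

/-- **APPENDING**: two families with the chain facts and the same source, glued by the cross link `T'₁ n₁ ⊆ X^{(0)}_0` of the second, give the chain
facts for the piecewise family `pw n₁ s₁ s₂` of length `n₁ + 1 + n₂ + 1`. [cite: KozmaNitzan2024, §4 Lemma 12 (pp. 23–25)] -/
theorem append {s₁ s₂ : ℕ → TStep G'} {T₁ T₂ : ℕ → Finset V} {n₁ n₂ : ℕ} (h₁ : ChainFacts W' p Δ' δ η o s₁ T₁ n₁)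
    (h₂ : ChainFacts W' p Δ' δ η o s₂ T₂ n₂) (hx : T₁ n₁ ⊆ (s₂ 0).L.X 0) :
    ChainFacts W' p Δ' δ η o (pw n₁ s₁ s₂) (pw n₁ T₁ T₂) (n₁ + 1 + n₂) where
  src k hk := by
    by_cases h : k ≤ n₁
    · rw [pw_of_le _ _ h]; exact h₁.src k h
    · rw [pw_of_not_le _ _ h]; exact h₂.src _ (by omega)
  link k hk := by
    by_cases h : k + 1 ≤ n₁
    · rw [pw_of_le _ _ (by omega), pw_of_le _ _ h]; exact h₁.link k h
    · by_cases h' : k = n₁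
      · subst h'
        rw [pw_of_le _ _ le_rfl, show k + 1 = k + 1 + 0 by omega, pw_add]; exact hx
      · obtain ⟨j, rfl⟩ : ∃ j, k = n₁ + 1 + j := ⟨k - (n₁ + 1), by omega⟩
        rw [pw_add, show n₁ + 1 + j + 1 = n₁ + 1 + (j + 1) by omega, pw_add]
        exact h₂.link j (by omega)
  sub k hk := by
    by_cases h : k ≤ n₁
    · rw [pw_of_le _ _ h, pw_of_le _ _ h]; exact h₁.sub k h
    · obtain ⟨j, rfl⟩ : ∃ j, k = n₁ + 1 + j := ⟨k - (n₁ + 1), by omega⟩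
      rw [pw_add, pw_add]; exact h₂.sub j (by omega)
  kits k hk := by
    by_cases h : k ≤ n₁
    · rw [pw_of_le _ _ h]; exact h₁.kits k h
    · obtain ⟨j, rfl⟩ : ∃ j, k = n₁ + 1 + j := ⟨k - (n₁ + 1), by omega⟩
      rw [pw_add]; exact h₂.kits j (by omega)
  exc k hk := by
    by_cases h : k ≤ n₁
    · rw [pw_of_le _ _ h, pw_of_le _ _ h]; exact h₁.exc k h
    · obtain ⟨j, rfl⟩ : ∃ j, k = n₁ + 1 + j := ⟨k - (n₁ + 1), by omega⟩
      rw [pw_add, pw_add]; exact h₂.exc j (by omega)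

omit [DecidableEq V] in
/-- The first step of an appended family is the first step of the first family. [folklore] -/
theorem pw_zero {β : Type*} (n : ℕ) (f g : ℕ → β) : pw n f g 0 = f 0 := pw_of_le _ _ (Nat.zero_le _)

omit [DecidableEq V] in
/-- The last entry of an appended family is the last entry of the second family. [folklore] -/
theorem pw_last {β : Type*} (n₁ n₂ : ℕ) (f g : ℕ → β) : pw n₁ f g (n₁ + 1 + n₂) = g n₂ := pw_add _ _ _ _

/-! ## §2 Applying the chain property -/

/-- **THE CHAIN PROPERTY APPLIED TO CHAIN FACTS**: the facts of length `n + 1`, the chain property at `(δ ↦ ε)`, a source bound on a part `B₀` of the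
first level, the last true target inside `Ft` with `P_{W'}(⋃_{t ∈ Ft} o ↔ t) ≤ μA` ⟹ `1 − ε < μA`.
[cite: KozmaNitzan2024, §4 Lemma 11 (pp. 22–23), Lemma 12 (pp. 23–25), p. 20 (Step IV)] -/
theorem lt_real {s : ℕ → TStep G'} {T' : ℕ → Finset V} {n : ℕ} (hF : ChainFacts W' p Δ' δ η o s T' n) {ε : ℝ} {B₀ Ft : Finset V} {μA : ℝ}
    (hchain : ∀ (W : Sym2 V → unitInterval) (s : Fin (n + 1) → TStep G') (T' : Fin (n + 1) → Finset V) (η : ℝ),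
      (∀ i, (s i).L.o = (s 0).L.o) →
      (∀ i : Fin n, T' (Fin.castSucc i) ⊆ (s i.succ).L.X 0) →
      (∀ i, T' i ⊆ (s i).T) →
      (∀ i, (s i).KitsAt W p Δ' δ) →
      η ≤ δ / 2 →
      (∀ i, (prodBernoulli W).real (⋃ t ∈ (s i).T \ T' i, openConn (s 0).L.o t) ≤ η) →
      1 - δ < (prodBernoulli W).real (s 0).L.reachB →
        1 - ε < (prodBernoulli W).real (⋃ t ∈ T' (Fin.last n), openConn (s 0).L.o t))
    (hη : η ≤ δ / 2) (hB₀ : B₀ ⊆ (s 0).L.X 0) (hsrc : 1 - δ < (prodBernoulli W').real (⋃ t ∈ B₀, openConn o t))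
    (hTn : T' n ⊆ Ft) (hdom : (prodBernoulli W').real (⋃ t ∈ Ft, openConn o t) ≤ μA) :
    1 - ε < μA := by
  have hle : ∀ i : Fin (n + 1), (i : ℕ) ≤ n := fun i => Nat.lt_succ_iff.1 i.2
  refine lt_real_of_chain G' hchain (fun i : Fin (n + 1) => s i) (fun i => T' i) (fun i => hF.src i (hle i)) (fun i => ?_)
    (fun i => hF.sub i (hle i)) (fun i => hF.kits i (hle i)) hη (fun i => hF.exc i (hle i)) ?_ (by rw [Fin.val_last]; exact hTn) hdom
  · -- the links
    show T' (Fin.castSucc i) ⊆ (s (i.succ : ℕ)).L.X 0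
    have e : ((i.succ : Fin (n + 1)) : ℕ) = (Fin.castSucc i : ℕ) + 1 := by simp
    rw [e]
    exact hF.link _ (by have := i.2; simp only [Fin.val_castSucc]; omega)
  · -- the source bound: `B₀ ⊆ X^{(0)}_0`
    show 1 - δ < (prodBernoulli W').real (s ((0 : Fin (n + 1)) : ℕ)).L.reachB
    rw [Fin.val_zero]
    refine hsrc.trans_le (measureReal_mono ?_ (measure_ne_top _ _))
    intro ω hω
    simp only [Set.mem_iUnion, exists_prop] at hω
    obtain ⟨t, ht, hωt⟩ := hω
    show ω ∈ ⋃ b ∈ (s 0).L.X 0, openConn (s 0).L.o b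
    rw [hF.src 0 (Nat.zero_le _)]
    exact Set.mem_biUnion (Finset.mem_coe.2 (hB₀ ht)) hωt

/-- **ROUTE-LAW FORM**: under `W' := Skel.routeW G Wt Qt S` (`o ∈ S ⊆ Qt`, `S ∩ Ft = ∅`) the same gives `1 − ε < P_{Wt}(linkIn Qt S Ft)`.
[cite: KozmaNitzan2024, §4 Lemma 11 (p. 22), p. 24 (P(o ↔^A ·)), p. 20 (Step IV)] -/
theorem lt_real_linkIn [Countable V] (G : SimpleGraph V) [G.LocallyFinite] {Wt : Sym2 V → unitInterval} {Qt Sd : Finset V}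
    {s : ℕ → TStep G'} {T' : ℕ → Finset V} {n : ℕ} (hF : ChainFacts (Skel.routeW G Wt Qt Sd) p Δ' δ η o s T' n) {ε : ℝ} {B₀ Ft : Finset V}
    (hchain : ∀ (W : Sym2 V → unitInterval) (s : Fin (n + 1) → TStep G') (T' : Fin (n + 1) → Finset V) (η : ℝ),
      (∀ i, (s i).L.o = (s 0).L.o) →
      (∀ i : Fin n, T' (Fin.castSucc i) ⊆ (s i.succ).L.X 0) →
      (∀ i, T' i ⊆ (s i).T) →
      (∀ i, (s i).KitsAt W p Δ' δ) →
      η ≤ δ / 2 →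
      (∀ i, (prodBernoulli W).real (⋃ t ∈ (s i).T \ T' i, openConn (s 0).L.o t) ≤ η) →
      1 - δ < (prodBernoulli W).real (s 0).L.reachB →
        1 - ε < (prodBernoulli W).real (⋃ t ∈ T' (Fin.last n), openConn (s 0).L.o t))
    (hη : η ≤ δ / 2) (hB₀ : B₀ ⊆ (s 0).L.X 0) (hsrc : 1 - δ < (prodBernoulli (Skel.routeW G Wt Qt Sd)).real (⋃ t ∈ B₀, openConn o t))
    (hTn : T' n ⊆ Ft) (hSQ : Sd ⊆ Qt) (hSF : Disjoint Sd Ft) (hoS : o ∈ Sd) :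
    1 - ε < (prodBernoulli Wt).real (linkIn (↑Qt : Set V) Sd Ft) :=
  hF.lt_real hchain hη hB₀ hsrc hTn (Skel.real_biUnion_openConn_routeW_le_linkIn G Wt hSQ hSF hoS)

end ChainFacts

end Skelφ

end Summit.CriticalPhenomena.PercolationContinuityZ3.Theorems.Transplant

end
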